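import Summits.Ventures.LatticeQCDFlow.Exactness.FlowSamplerSwapInvolution
import HarnessLib

/-!
# The exact flow sampler's acceptance COUNTS WEIGHT INCREASES TWICE:
# `ā·Z = P(b(X) ≤ b(Y)) + P(b(X) < b(Y))`, `X ∼ e^{−S}`, `Y ∼ q̃` independent, `b = e^{−S}/q̃`

HONEST FRAMING: exact (Metropolis-corrected) sampling algorithms for lattice gauge theory;
figures of merit are autocorrelation/cost numbers at stated couplings and volumes; no
continuum-physics claim.  (SCALAR calibration rung S0-A: not a gauge result.)

Venture `LatticeQCDFlow` (cell pub-lqcd), topic `Exactness`; FANOUT row 2 (`s0-phi4`, FLOW arm: the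
acceptance column).  NEW WORK of the cell — a two-step composition of row 2's
`FlowSamplerSwapInvolution` (the independence Metropolis step IS the swap involution on `X × X`:
`H(x,y) = −log w(x) − log q̃(y)`, `ΔH = log b(x) − log b(y)`, `min(1, e^{−ΔH}) = imhAcceptQ`) with
`Phi4HMCFluctuationRelation.acceptance_integral_eq` (for every measure-preserving involution the
equilibrium acceptance is `P(ΔH ≤ 0) + P(ΔH < 0)`).  Nothing is cited as a fact; no definition.
Printed counterpart NAMED ONLY: Liu 1996 (the IMH acceptance in terms of the weights).  Siblings:
`FlowAcceptanceOverlap` (`m² ≤ ā ≤ m`), `Scaling/AcceptanceGiniFloor*` (`1 − ā` = the Gini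
coefficient of the weights), `IMHRejectionCurve` (the per-state acceptance `ρ(x)` as a curve in
`b(x)`) — all consistent with, none stating, the two-event form below.

## What is proved (`(X, μ)` s-finite; `w, q̃ > 0` measurable integrable; `b = w/q̃`;
`α = imhAcceptQ w q̃`; the product measure `μ ⊗ μ` weighted by `w(x) q̃(y)`)

* `imh_meanAccept_eq_integral_swap` — the iterated acceptance integral `∫ w(x) ∫ α(x,y) q̃(y)` is the
  involutive acceptance integral `∫ min(1, e^{−ΔH}) e^{−H} d(μ⊗μ)` of the swap;
* **`imh_meanAccept_eq_weightOrder`** —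
  `∫ w(x) ∫ α(x,y) q̃(y) = ∫∫ 𝟙[b(x) ≤ b(y)] w(x)q̃(y) + ∫∫ 𝟙[b(x) < b(y)] w(x)q̃(y)`:
  the equilibrium acceptance is the probability that an independent proposal's weight is AT LEAST
  the current state's, plus the probability that it is STRICTLY larger (current state drawn from the
  target, proposal from the model);
* **`imh_meanAccept_eq_two_mul_of_noTies`** — if ties `b(X) = b(Y)` are null, `ā·Z = 2·P(b(X) < b(Y))`;
* lattice φ⁴ (`λ > 0`, real `J`, every positive flow): **`phi4Flow_meanAccept_eq_weightOrder`**.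

Reading for S0-A and the battery (no numerics implied): the acceptance column of a flow arm is
predicted, before any chain is run, by the fraction of (target draw, model draw) pairs in which the
model draw carries the larger importance weight — counted twice; with stored HMC-arm configurations
as target draws this is a two-sample check of the flow arm's reported acceptance that uses no chain
output.  The companion file `GaussianFlowModeAcceptance` evaluates the two events in closed form for a
Gaussian flow on one Gaussian mode.  NOT CLAIMED: any value for any network; that ties are null for a
given flow (they are whenever `b` has a continuous law under `μ ⊗ μ`); finite-sample statements.
-/

namespace Summit.Ventures.LatticeQCDFlow.Exactness

open Real MeasureTheory Filter Set
open Summit.Ventures.LatticeQCDFlow.Scoring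

section General

variable {X : Type*} [MeasurableSpace X] {μ : Measure X} [SFinite μ] {w q : X → ℝ}

/-- The iterated equilibrium acceptance integral is the involutive acceptance integral of the swap
on `X × X` (`H(x,y) = −log w(x) − log q̃(y)`). -/
theorem imh_meanAccept_eq_integral_swap (hw0 : ∀ t, 0 < w t) (hwm : Measurable w)
    (hwi : Integrable w μ) (hq0 : ∀ t, 0 < q t) (hqm : Measurable q) (hqi : Integrable q μ) :
    ∫ x, w x * (∫ y, imhAcceptQ w q x y * q y ∂μ) ∂μ
      = ∫ z, min 1 (Real.exp (-deltaH (fun z : X × X => -Real.log (w z.1) - Real.log (q z.2))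
          Prod.swap z)) * Real.exp (-(-Real.log (w z.1) - Real.log (q z.2))) ∂(μ.prod μ) := by
  have e : (fun z : X × X => min 1 (Real.exp (-deltaH (fun z : X × X =>
      -Real.log (w z.1) - Real.log (q z.2)) Prod.swap z)) * Real.exp (-(-Real.log (w z.1) - Real.log (q z.2))))
      = fun z => w z.1 * (imhAcceptQ w q z.1 z.2 * q z.2) := by
    funext z
    rw [imhAcceptQ_eq_min_exp_neg_deltaH hw0 hq0 z, swapEnergy_exp_neg hw0 hq0 z]
    ring
  rw [e]
  have hint : Integrable (fun z : X × X => w z.1 * (imhAcceptQ w q z.1 z.2 * q z.2)) (μ.prod μ) := by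
    refine (hwi.mul_prod hqi).mono' ?_ (Eventually.of_forall fun z => ?_)
    · exact ((hwm.comp measurable_fst).mul
        ((measurable_imhAcceptQ hwm hqm).mul (hqm.comp measurable_snd))).aestronglyMeasurable
    · have ha := imhAcceptQ_nonneg hw0 hq0 z.1 z.2
      have ha1 := imhAcceptQ_le_one w q z.1 z.2
      rw [Real.norm_eq_abs, abs_of_nonneg (mul_nonneg (hw0 _).le (mul_nonneg ha (hq0 _).le))]
      exact mul_le_mul_of_nonneg_left (mul_le_of_le_one_left (hq0 z.2).le ha1) (hw0 _).le
  rw [integral_prod _ hint]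
  exact integral_congr_ae (Eventually.of_forall fun x => by
    dsimp only
    rw [integral_const_mul])

/-- **THE EQUILIBRIUM ACCEPTANCE OF THE EXACT FLOW SAMPLER COUNTS WEIGHT INCREASES TWICE**: for
`w, q̃ > 0` measurable integrable, with `b = w/q̃`, `X ∼ w` (unnormalised) and an independent
proposal `Y ∼ q̃`:
`∫ w(x) ∫ α(x,y) q̃(y) = (wμ ⊗ q̃μ){b(X) ≤ b(Y)} + (wμ ⊗ q̃μ){b(X) < b(Y)}`
— the swap involution's `acc = P(ΔH ≤ 0) + P(ΔH < 0)` with `ΔH = log b(x) − log b(y)`. -/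
theorem imh_meanAccept_eq_weightOrder (hw0 : ∀ t, 0 < w t) (hwm : Measurable w)
    (hwi : Integrable w μ) (hq0 : ∀ t, 0 < q t) (hqm : Measurable q) (hqi : Integrable q μ) :
    ∫ x, w x * (∫ y, imhAcceptQ w q x y * q y ∂μ) ∂μ
      = (∫ z, (if w z.1 / q z.1 ≤ w z.2 / q z.2 then (1 : ℝ) else 0) * (w z.1 * q z.2) ∂(μ.prod μ))
        + ∫ z, (if w z.1 / q z.1 < w z.2 / q z.2 then (1 : ℝ) else 0) * (w z.1 * q z.2) ∂(μ.prod μ) := by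
  set H : X × X → ℝ := fun z => -Real.log (w z.1) - Real.log (q z.2) with hH
  have hHm : Measurable H :=
    ((Real.measurable_log.comp (hwm.comp measurable_fst)).neg).sub
      (Real.measurable_log.comp (hqm.comp measurable_snd))
  have hΨμ : MeasurePreserving (Prod.swap : X × X → X × X) (μ.prod μ) (μ.prod μ) :=
    Measure.measurePreserving_swap
  have hΨi : Function.Involutive (Prod.swap : X × X → X × X) := fun p => Prod.swap_swap p
  have hexp : Integrable (fun z => Real.exp (-H z)) (μ.prod μ) := by
    have h : Integrable (fun p : X × X => w p.1 * q p.2) (μ.prod μ) := hwi.mul_prod hqi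
    exact h.congr (Eventually.of_forall fun p => (swapEnergy_exp_neg hw0 hq0 p).symm)
  rw [imh_meanAccept_eq_integral_swap hw0 hwm hwi hq0 hqm hqi,
    acceptance_integral_eq hHm measurable_swap hΨi hΨμ hexp]
  have hb : ∀ z : X × X, 0 < w z.1 / q z.1 := fun z => div_pos (hw0 _) (hq0 _)
  have hb' : ∀ z : X × X, 0 < w z.2 / q z.2 := fun z => div_pos (hw0 _) (hq0 _)
  have hle : ∀ z : X × X, (deltaH H Prod.swap z ≤ 0) ↔ (w z.1 / q z.1 ≤ w z.2 / q z.2) := fun z => by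
    rw [hH, deltaH_swap_eq hw0 hq0 z, sub_nonpos, Real.log_le_log_iff (hb z) (hb' z)]
  have hlt : ∀ z : X × X, (deltaH H Prod.swap z < 0) ↔ (w z.1 / q z.1 < w z.2 / q z.2) := fun z => by
    rw [hH, deltaH_swap_eq hw0 hq0 z, sub_neg, Real.log_lt_log_iff (hb z) (hb' z)]
  congr 1
  · refine integral_congr_ae (Eventually.of_forall fun z => ?_)
    simp only [hle z]
    congr 1
    exact swapEnergy_exp_neg hw0 hq0 z
  · refine integral_congr_ae (Eventually.of_forall fun z => ?_)
    simp only [hlt z]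
    congr 1
    exact swapEnergy_exp_neg hw0 hq0 z

/-- **When the importance weight has no ties across (target, model)** — the event `b(X) = b(Y)` is
null for `wμ ⊗ q̃μ` (e.g. `b` a strictly monotone function of a coordinate with a density) — the
acceptance is TWICE the probability that the proposal's weight exceeds the current state's:
`∫ w ∫ α q̃ = 2·(wμ ⊗ q̃μ){b(X) < b(Y)}`. -/
theorem imh_meanAccept_eq_two_mul_of_noTies (hw0 : ∀ t, 0 < w t) (hwm : Measurable w)
    (hwi : Integrable w μ) (hq0 : ∀ t, 0 < q t) (hqm : Measurable q) (hqi : Integrable q μ)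
    (hties : ∫ z, (if w z.1 / q z.1 = w z.2 / q z.2 then (1 : ℝ) else 0) * (w z.1 * q z.2) ∂(μ.prod μ) = 0) :
    ∫ x, w x * (∫ y, imhAcceptQ w q x y * q y ∂μ) ∂μ
      = 2 * ∫ z, (if w z.1 / q z.1 < w z.2 / q z.2 then (1 : ℝ) else 0) * (w z.1 * q z.2) ∂(μ.prod μ) := by
  rw [imh_meanAccept_eq_weightOrder hw0 hwm hwi hq0 hqm hqi, two_mul]
  congr 1
  -- `𝟙[b x ≤ b y] = 𝟙[b x < b y] + 𝟙[b x = b y]` and the tie term integrates to zero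
  have hwq : Integrable (fun z : X × X => w z.1 * q z.2) (μ.prod μ) := hwi.mul_prod hqi
  have hbm : Measurable fun z : X × X => w z.1 / q z.1 :=
    (hwm.comp measurable_fst).div (hqm.comp measurable_fst)
  have hbm' : Measurable fun z : X × X => w z.2 / q z.2 :=
    (hwm.comp measurable_snd).div (hqm.comp measurable_snd)
  have hwqm : Measurable fun z : X × X => w z.1 * q z.2 :=
    (hwm.comp measurable_fst).mul (hqm.comp measurable_snd)
  have hbdd : ∀ (c : X × X → Prop) [DecidablePred c], (Measurable fun z => if c z then (1 : ℝ) else 0) →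
      Integrable (fun z : X × X => (if c z then (1 : ℝ) else 0) * (w z.1 * q z.2)) (μ.prod μ) := by
    intro c _ hc
    refine hwq.mono' (hc.mul hwqm).aestronglyMeasurable (Eventually.of_forall fun z => ?_)
    have h0 : 0 ≤ w z.1 * q z.2 := mul_nonneg (hw0 _).le (hq0 _).le
    rw [Real.norm_eq_abs, abs_of_nonneg (mul_nonneg (by split_ifs <;> norm_num) h0)]
    exact mul_le_of_le_one_left h0 (by split_ifs <;> norm_num)
  have hIlt := hbdd (fun z => w z.1 / q z.1 < w z.2 / q z.2)
    (Measurable.ite (measurableSet_lt hbm hbm') measurable_const measurable_const)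
  have hIeq := hbdd (fun z => w z.1 / q z.1 = w z.2 / q z.2)
    (Measurable.ite (measurableSet_eq_fun hbm hbm') measurable_const measurable_const)
  have e : (fun z : X × X => (if w z.1 / q z.1 ≤ w z.2 / q z.2 then (1 : ℝ) else 0) * (w z.1 * q z.2))
      = fun z => (if w z.1 / q z.1 < w z.2 / q z.2 then (1 : ℝ) else 0) * (w z.1 * q z.2)
        + (if w z.1 / q z.1 = w z.2 / q z.2 then (1 : ℝ) else 0) * (w z.1 * q z.2) := by
    funext z
    rcases lt_trichotomy (w z.1 / q z.1) (w z.2 / q z.2) with h | h | h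
    · rw [if_pos h.le, if_pos h, if_neg h.ne]; ring
    · rw [if_pos h.le, if_neg (by rw [h]; exact lt_irrefl _), if_pos h]; ring
    · rw [if_neg (not_le.mpr h), if_neg (not_lt.mpr h.le), if_neg h.ne']; ring
  rw [e, integral_add hIlt hIeq, hties, add_zero]

end General

/-! ## §2 Row 2's lattice φ⁴ flow sampler -/

section Lattice

variable {n : ℕ}

/-- **Lattice φ⁴** (`λ > 0`, real `J`, every positive measurable integrable flow density `q̃`):
the unnormalised equilibrium acceptance `∫ e^{−S(φ)} ∫ α(φ,φ') q̃(φ') dφ' dφ` of the exact flow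
sampler equals `(e^{−S}dφ ⊗ q̃ dφ'){b(φ) ≤ b(φ')} + (e^{−S}dφ ⊗ q̃ dφ'){b(φ) < b(φ')}`,
`b = e^{−S}/q̃`. -/
theorem phi4Flow_meanAccept_eq_weightOrder {lam : ℝ} (hlam : 0 < lam)
    (J : Fin (n + 1) → Fin (n + 1) → ℝ) {q : (Fin (n + 1) → ℝ) → ℝ} (hq0 : ∀ φ, 0 < q φ)
    (hqm : Measurable q) (hqi : Integrable q) :
    ∫ φ, gibbsWeight J lam φ * (∫ φ', imhAcceptQ (gibbsWeight J lam) q φ φ' * q φ')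
      = (∫ z, (if gibbsWeight J lam z.1 / q z.1 ≤ gibbsWeight J lam z.2 / q z.2 then (1 : ℝ) else 0)
          * (gibbsWeight J lam z.1 * q z.2) ∂((volume : Measure (Fin (n + 1) → ℝ)).prod volume))
        + ∫ z, (if gibbsWeight J lam z.1 / q z.1 < gibbsWeight J lam z.2 / q z.2 then (1 : ℝ) else 0)
          * (gibbsWeight J lam z.1 * q z.2) ∂((volume : Measure (Fin (n + 1) → ℝ)).prod volume) :=
  imh_meanAccept_eq_weightOrder (μ := volume) (fun φ => gibbsWeight_pos J lam φ)
    (continuous_gibbsWeight J lam).measurable (integrable_gibbsWeight hlam J) hq0 hqm hqi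

end Lattice

end Summit.Ventures.LatticeQCDFlow.Exactness
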